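import Summits.BirchSwinnertonDyer.BirchSwinnertonDyer.Theorems.KatoDescentPotSupersingularWildConjAResidueUnitIndexRows02
import Literature.NumberTheory.EllipticCurves.FineSelmerLimThm35Proofs
import Literature.NumberTheory.EllipticCurves.FineSelmerClassGroupCriterionThm34Proofs
import Literature.NumberTheory.IwasawaTheory.Fukuda1994Thm1Proofs
import Literature.NumberTheory.IwasawaTheory.Fukuda1994Thm1RankProofs
import HarnessLib

/-!
# NoF RE-ISSUE (seat `bsd-potss-k9-c4` g25, 2026-08-29; `--supports stmt-BirchSwinnertonDyer-19197 --as helper`) of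
# `KatoDescentPotSupersingularWildConjAResidueUnitIndexRows02.lean`:
# the SAME per-row theorems with the μ-road named facts that are now TREE THEOREMS no longer displayed as hypotheses —
# `hLim` (Lim 2017 Thm. 3.5) := `Lim2017.thm35_fineSelmerDual_moduleFinite_of_classicalMuVanishes_of_le_divisionField_holds` (rkm g34, p695193),
# `hF1` (Fukuda 1994 Thm. 1 (1)) := `IwasawaTheory.fukuda1994_thm1_classNumberPExp_const_of_succ_eq_holds` (k8t-c4 g20),
# `hF2` (Fukuda 1994 Thm. 1 (2)) := `IwasawaTheory.fukuda1994_thm1_classGroupPRank_const_of_succ_eq_holds` (k8t-c4 g20, p681350),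
# `hCS` (Coates–Sujatha 2005 Thm. 3.4) := `CoatesSujatha2005.thm34_fineSelmerDual_moduleFinite_of_classicalMuVanishes_divisionField_holds` (k8t-c4 g22, p694085).

HONEST FRAMING. THEOREMS ONLY; PER ROW; nothing booked; items 19189 / 19197 / 19942 stay OPEN at class level (open input of record: the zeta crux 24327);
(A) / Conjecture A / BSD proved for NO class of curves.  Every theorem below is the original record (same name + suffix `NoF`, same displayed NUMERIC
hypotheses, same kernel certificates, same proof term) with the discharged fact binders deleted and the `_holds` theorems substituted in the proof; the
remaining displayed named facts are exactly those the original displays minus {hLim, hF1, hF2, hCS} (for the `GL₂(𝔽₃)` `L_P`-road records: NONE beyond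
`hKatoA hGZK hmod` on the U₀ twin — statement (A) at `(E,3)` becomes a kernel theorem modulo the displayed numerics of `L_P` alone; for the Cartan
unit-index / Fukuda records: Ferrero–Washington `hFW` only).  Row section headers, numerics, evidence pointers and citations are those of the original
file VERBATIM (its module docstring is reproduced below under «ORIGINAL HEADER»); the per-theorem docstrings are the originals prefixed with the NoF marker.

ORIGINAL HEADER of `KatoDescentPotSupersingularWildConjAResidueUnitIndexRows02`:

> # Route `KatoDescentPotSupersingular` (rung K9, sub-rung B5 = O6 wild `p = 3`, cell `bsd-potss`): `3Ns` RESIDUE ROWS of the Conj-A crux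
> # `WildCoatesSujathaResidue` (19942; U₀-ns node 19189 → parent 19197 `WildUpperDefectRankZero`) whose maximal real subfield `K⁺ = ℚ(E[3])⁺`
> # GROWS at layers `(0,1)` and SETTLES at `(1,2)` — (A) / U₀ per row with the classical `μ`-hypothesis DISCHARGED modulo Fukuda 1994 Thm. 1
> # from displayed, PARI-computed layer data (part 02: 28566bk1, 371358bt1, 228150bi1, 228150bv1)
> # (seat `bsd-potss-k9-c4` g19; `--supports stmt-BirchSwinnertonDyer-19197 --as helper`)
> 
> HONEST FRAMING. THEOREMS ONLY (no definition, no named fact, no `sorry`); PER ROW — NOT a class theorem; nothing is booked; items 19942 / 19189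
> / 19197 stay OPEN at class level (open input: the zeta crux 24327 `WildKatoZetaIndivisible`); Coates–Sujatha's (A), Conjecture A and BSD are
> proved for NO curve here.  g18's records on these rows (`…WildConjAResidueCartanRows01–05`) DISPLAY `hμ` («`μ = 0` for the cyclotomic
> `ℤ_3`-extension of `K⁺`»).  THIS FILE replaces `hμ` by Fukuda's criterion at layers `(1, 2)` of the cyclotomic `ℤ_3`-tower of `K⁺` (doors
> `UnitIndexMuDoors.…_of_realSuccEqAt` / `…_of_realRankSuccEqAt`, this seat): displayed per row = Fukuda index `0` (`hram`: both primes of `K⁺` above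
> `3` have `e·f = 2`, prime to `3` — exact) and the equality of consecutive layer invariants (`hord` / `hrk`).  NUMERICS (kit j308602, `--workitem
> 19197`, PARI/GP 2.17; `K⁺_n = K⁺·ℚ_n`, `ℚ_n ⊂ ℚ(ζ_{3^{n+1}})` of degree `3^n`): `ℚ[x]/(x⁴−x³−14x²+33x−15)` (rows 28566bk1, 371358bt1): `h = 1 → 3 → 3`, `e = 0, 1, 1`; `ℚ[x]/(x⁴−39x²−130x−156)` (228150bi1/bv1): `h = 2 → 6 → 6`, `e = 0, 1, 1` ⟹ Thm. 1 (1) at `(1,2)`.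
> Layer `0` and `1` class numbers CERTIFIED (`bnfcertify`), layer `2` (degree 36) under GRH — said in each docstring.  KERNEL per row (g18,
> imported): `Δ ≠ 0`, minimality, `E[3]` irreducible, `ClassO6 E 3`, the `3Ns` image.  Data: HOME/k9-c4/g19/.
> 
> References: [Fukuda1994] Thm. 1 (1), (2); [CoatesSujatha2005] Thm. 3.4; [Kato2004Asterisque] Thm. 14.5 (3); [Serre1972] §2.2, §5.2; [Cremona2006] Table 1.
> 
-/

set_option autoImplicit false
set_option linter.dupNamespace false

noncomputable section

open scoped Classical NumberField
open WeierstrassCurve NumberField IsDedekindDomain Field IntermediateField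
  Literature.NumberTheory.EllipticCurves Literature.NumberTheory.EllipticCurves.Rank1Residual
  Literature.NumberTheory.EllipticCurves.Rank1Residual.Typed
  Literature.NumberTheory.GaloisRepresentations Literature.NumberTheory.SerreUniformity Literature.NumberTheory.IwasawaTheory
  Summit.BirchSwinnertonDyer.Rank1Residual Summit.BirchSwinnertonDyer.Rank1Residual.Additive
  Summit.BirchSwinnertonDyer.BirchSwinnertonDyer.Theorems

namespace Summit.BirchSwinnertonDyer.BirchSwinnertonDyer.Theorems.WildUpperUnitTwistRecords

/-! ### `28566bk1` @ `p = 3` (`3Ns`; `K⁺ = ℚ[x]/(x⁴ − x³ − 14x² + 33x − 15)`: `h = 1, 3, 3` at layers `0, 1, 2` (CERT, CERT, GRH), `e = 0, 1, 1`) -/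

set_option synthInstance.maxHeartbeats 400000 in
set_option maxHeartbeats 4000000 in
/-- **[NoF re-issue: the named facts `hLim`/`hF1`/`hF2`/`hCS` displayed by the original are DISCHARGED here by the tree theorems `…_holds` — read «modulo hLim/hF1/hF2/hCS» below as «no longer assumed».]** **(A) AT `(28566bk1, 3)` with `hμ` DISCHARGED by FUKUDA Thm. 1 (1) at layers `(1,2)` (`e₁ = e₂`)** (modulo `hCS`, `hFW`, `hF1`): `c` a complex conjugation, `Kp = ℚ(E[3])^c`
(`hKp`; `K⁺ = ℚ[x]/(x⁴ − x³ − 14x² + 33x − 15)`: `h = 1, 3, 3` at layers `0, 1, 2` (CERT, CERT, GRH), `e = 0, 1, 1`), displayed numerics: Fukuda index `0` (`hram`, exact) and `hord` (layer `1` certified, layer `2` under GRH; kit j308602).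
KERNEL: the `3Ns` image (g18). CONDITIONAL; nothing booked; (A)/BSD proved for no curve. [cite: Fukuda1994, Thm. 1 (1), p. 264] [cite: CoatesSujatha2005, Thm. 3.4 (§3)]
[cite: Cremona2006, Table 1 (Cremona label 28566bk1)] -/
theorem conjA_g28566bk1_3_fk12NoF
    (hFW : ferreroWashington1979_classicalMuVanishes)
    {W : WeierstrassCurve ℚ} [W.IsElliptic] (hWeq : W = (⟨1, (-1), 1, (-800741), (-265902371)⟩ : WeierstrassCurve ℚ))
    {c : absoluteGaloisGroup ℚ} (hc : IsComplexConjugation (Rat.castHom ℝ) c)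
    (Kp : IntermediateField ℚ ↥(W.divisionField 3)) (hKp : Kp = fixedField (Subgroup.zpowers (absRestrictNormalHom (W.divisionField 3) c)))
    (hram : ∀ κE : ZpExtension ↥Kp 3, κE.IsCyclotomic → TotallyRamifiedFrom κE 0)
    (hord : ∀ κE : ZpExtension ↥Kp 3, κE.IsCyclotomic → classNumberPExp κE (1 + 1) = classNumberPExp κE 1)
    (κ : ZpExtension ℚ 3) (hκ : κ.IsCyclotomic) :
    ∃ (γ : absoluteGaloisGroup ℚ) (Df : W.FineSelmerDualData κ γ),
      Module.Finite ℤ_[3] (RestrictScalars ℤ_[3] (IwasawaAlgebra 3) Df.X) := by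
  subst hWeq
  exact UnitIndexMuDoors.conjA_three_of_hasSplitCartanNormalizerModPImage_of_realSuccEqAt _ CoatesSujatha2005.thm34_fineSelmerDual_moduleFinite_of_classicalMuVanishes_divisionField_holds hFW fukuda1994_thm1_classNumberPExp_const_of_succ_eq_holds
    hasSplitCartanNormalizerModPImage_g28566bk1_3 hc Kp hKp 1 hram hord κ hκ

set_option synthInstance.maxHeartbeats 400000 in
set_option maxHeartbeats 4000000 in
/-- **[NoF re-issue: the named facts `hLim`/`hF1`/`hF2`/`hCS` displayed by the original are DISCHARGED here by the tree theorems `…_holds` — read «modulo hLim/hF1/hF2/hCS» below as «no longer assumed».]** **RECORD — U₀ `ord₃ #Ш(E) ≤ ord₃ #Ш_an(E)` for `E = 28566bk1` with `hμ` DISCHARGED by FUKUDA Thm. 1 (1) at layers `(1,2)` (`e₁ = e₂`)**: named facts {A161-fine `hKatoA`, GZK `hGZK`,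
modularity `hmod`, `hCS`, `hFW`, `hF1`}, Cremona's `r_an = 0` (`hr`), and the displayed layer data `hram` / `hord` of `Kp = ℚ(E[3])^c` (`K⁺ = ℚ[x]/(x⁴ − x³ − 14x² + 33x − 15)`: `h = 1, 3, 3` at layers `0, 1, 2` (CERT, CERT, GRH), `e = 0, 1, 1`;
kit j308602). KERNEL (g18): elliptic, minimal, `ClassO6 E 3`, `E[3]` irreducible, `3Ns` image. Supersedes the displayed-`hμ` record
`missingUpperBoundAt_g28566bk1_3`. Per row; nothing booked; BSD proved for no curve. [cite: Kato2004Asterisque, Thm. 14.5 (3) (p. 236)] [cite: Fukuda1994, Thm. 1 (1), p. 264]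
[cite: Cremona2006, Table 1 (Cremona label 28566bk1)] -/
theorem missingUpperBoundAt_g28566bk1_3_fk12NoF
    (hKatoA : Kato2004.rankZero_padicValNat_sha_add_padicValNat_tamagawa_le_of_additive_potGood_of_irreducible_of_fineSelmerDual_fg)
    (hGZK : rank_eq_analyticRank_of_analyticRank_le_one) (hmod : hasEntireLFunction_rat)
    (hFW : ferreroWashington1979_classicalMuVanishes)
    {W : WeierstrassCurve ℚ} [W.IsElliptic] [W.IsGloballyMinimal] (hWeq : W = (⟨1, (-1), 1, (-800741), (-265902371)⟩ : WeierstrassCurve ℚ)) (hr : W.analyticRank = 0)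
    {c : absoluteGaloisGroup ℚ} (hc : IsComplexConjugation (Rat.castHom ℝ) c)
    (Kp : IntermediateField ℚ ↥(W.divisionField 3)) (hKp : Kp = fixedField (Subgroup.zpowers (absRestrictNormalHom (W.divisionField 3) c)))
    (hram : ∀ κE : ZpExtension ↥Kp 3, κE.IsCyclotomic → TotallyRamifiedFrom κE 0)
    (hord : ∀ κE : ZpExtension ↥Kp 3, κE.IsCyclotomic → classNumberPExp κE (1 + 1) = classNumberPExp κE 1) :
    MissingUpperBoundAt W 3 := by
  subst hWeq
  haveI : Fact (Nat.Prime 3) := ⟨Nat.prime_three⟩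
  exact UnitIndexMuDoors.missingUpperBoundAt_three_of_hasSplitCartanNormalizerModPImage_of_realSuccEqAt _ hKatoA hGZK hmod CoatesSujatha2005.thm34_fineSelmerDual_moduleFinite_of_classicalMuVanishes_divisionField_holds hFW fukuda1994_thm1_classNumberPExp_const_of_succ_eq_holds
    hr classO6_g28566bk1_3 irr_g28566bk1_3 hasSplitCartanNormalizerModPImage_g28566bk1_3 hc Kp hKp 1 hram hord

/-! ### `371358bt1` @ `p = 3` (`3Ns`; `K⁺ = ℚ[x]/(x⁴ − x³ − 14x² + 33x − 15)`: `h = 1, 3, 3` at layers `0, 1, 2` (CERT, CERT, GRH), `e = 0, 1, 1`) -/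

set_option synthInstance.maxHeartbeats 400000 in
set_option maxHeartbeats 4000000 in
/-- **[NoF re-issue: the named facts `hLim`/`hF1`/`hF2`/`hCS` displayed by the original are DISCHARGED here by the tree theorems `…_holds` — read «modulo hLim/hF1/hF2/hCS» below as «no longer assumed».]** **(A) AT `(371358bt1, 3)` with `hμ` DISCHARGED by FUKUDA Thm. 1 (1) at layers `(1,2)` (`e₁ = e₂`)** (modulo `hCS`, `hFW`, `hF1`): `c` a complex conjugation, `Kp = ℚ(E[3])^c`
(`hKp`; `K⁺ = ℚ[x]/(x⁴ − x³ − 14x² + 33x − 15)`: `h = 1, 3, 3` at layers `0, 1, 2` (CERT, CERT, GRH), `e = 0, 1, 1`), displayed numerics: Fukuda index `0` (`hram`, exact) and `hord` (layer `1` certified, layer `2` under GRH; kit j308602).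
KERNEL: the `3Ns` image (g18). CONDITIONAL; nothing booked; (A)/BSD proved for no curve. [cite: Fukuda1994, Thm. 1 (1), p. 264] [cite: CoatesSujatha2005, Thm. 3.4 (§3)]
[cite: Cremona2006, Table 1 (Cremona label 371358bt1)] -/
theorem conjA_g371358bt1_3_fk12NoF
    (hFW : ferreroWashington1979_classicalMuVanishes)
    {W : WeierstrassCurve ℚ} [W.IsElliptic] (hWeq : W = (⟨1, (-1), 1, (-4169908460), (-103656052960145)⟩ : WeierstrassCurve ℚ))
    {c : absoluteGaloisGroup ℚ} (hc : IsComplexConjugation (Rat.castHom ℝ) c)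
    (Kp : IntermediateField ℚ ↥(W.divisionField 3)) (hKp : Kp = fixedField (Subgroup.zpowers (absRestrictNormalHom (W.divisionField 3) c)))
    (hram : ∀ κE : ZpExtension ↥Kp 3, κE.IsCyclotomic → TotallyRamifiedFrom κE 0)
    (hord : ∀ κE : ZpExtension ↥Kp 3, κE.IsCyclotomic → classNumberPExp κE (1 + 1) = classNumberPExp κE 1)
    (κ : ZpExtension ℚ 3) (hκ : κ.IsCyclotomic) :
    ∃ (γ : absoluteGaloisGroup ℚ) (Df : W.FineSelmerDualData κ γ),
      Module.Finite ℤ_[3] (RestrictScalars ℤ_[3] (IwasawaAlgebra 3) Df.X) := by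
  subst hWeq
  exact UnitIndexMuDoors.conjA_three_of_hasSplitCartanNormalizerModPImage_of_realSuccEqAt _ CoatesSujatha2005.thm34_fineSelmerDual_moduleFinite_of_classicalMuVanishes_divisionField_holds hFW fukuda1994_thm1_classNumberPExp_const_of_succ_eq_holds
    hasSplitCartanNormalizerModPImage_g371358bt1_3 hc Kp hKp 1 hram hord κ hκ

set_option synthInstance.maxHeartbeats 400000 in
set_option maxHeartbeats 4000000 in
/-- **[NoF re-issue: the named facts `hLim`/`hF1`/`hF2`/`hCS` displayed by the original are DISCHARGED here by the tree theorems `…_holds` — read «modulo hLim/hF1/hF2/hCS» below as «no longer assumed».]** **RECORD — U₀ `ord₃ #Ш(E) ≤ ord₃ #Ш_an(E)` for `E = 371358bt1` with `hμ` DISCHARGED by FUKUDA Thm. 1 (1) at layers `(1,2)` (`e₁ = e₂`)**: named facts {A161-fine `hKatoA`, GZK `hGZK`,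
modularity `hmod`, `hCS`, `hFW`, `hF1`}, Cremona's `r_an = 0` (`hr`), and the displayed layer data `hram` / `hord` of `Kp = ℚ(E[3])^c` (`K⁺ = ℚ[x]/(x⁴ − x³ − 14x² + 33x − 15)`: `h = 1, 3, 3` at layers `0, 1, 2` (CERT, CERT, GRH), `e = 0, 1, 1`;
kit j308602). KERNEL (g18): elliptic, minimal, `ClassO6 E 3`, `E[3]` irreducible, `3Ns` image. Supersedes the displayed-`hμ` record
`missingUpperBoundAt_g371358bt1_3`. Per row; nothing booked; BSD proved for no curve. [cite: Kato2004Asterisque, Thm. 14.5 (3) (p. 236)] [cite: Fukuda1994, Thm. 1 (1), p. 264]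
[cite: Cremona2006, Table 1 (Cremona label 371358bt1)] -/
theorem missingUpperBoundAt_g371358bt1_3_fk12NoF
    (hKatoA : Kato2004.rankZero_padicValNat_sha_add_padicValNat_tamagawa_le_of_additive_potGood_of_irreducible_of_fineSelmerDual_fg)
    (hGZK : rank_eq_analyticRank_of_analyticRank_le_one) (hmod : hasEntireLFunction_rat)
    (hFW : ferreroWashington1979_classicalMuVanishes)
    {W : WeierstrassCurve ℚ} [W.IsElliptic] [W.IsGloballyMinimal] (hWeq : W = (⟨1, (-1), 1, (-4169908460), (-103656052960145)⟩ : WeierstrassCurve ℚ)) (hr : W.analyticRank = 0)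
    {c : absoluteGaloisGroup ℚ} (hc : IsComplexConjugation (Rat.castHom ℝ) c)
    (Kp : IntermediateField ℚ ↥(W.divisionField 3)) (hKp : Kp = fixedField (Subgroup.zpowers (absRestrictNormalHom (W.divisionField 3) c)))
    (hram : ∀ κE : ZpExtension ↥Kp 3, κE.IsCyclotomic → TotallyRamifiedFrom κE 0)
    (hord : ∀ κE : ZpExtension ↥Kp 3, κE.IsCyclotomic → classNumberPExp κE (1 + 1) = classNumberPExp κE 1) :
    MissingUpperBoundAt W 3 := by
  subst hWeq
  haveI : Fact (Nat.Prime 3) := ⟨Nat.prime_three⟩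
  exact UnitIndexMuDoors.missingUpperBoundAt_three_of_hasSplitCartanNormalizerModPImage_of_realSuccEqAt _ hKatoA hGZK hmod CoatesSujatha2005.thm34_fineSelmerDual_moduleFinite_of_classicalMuVanishes_divisionField_holds hFW fukuda1994_thm1_classNumberPExp_const_of_succ_eq_holds
    hr classO6_g371358bt1_3 irr_g371358bt1_3 hasSplitCartanNormalizerModPImage_g371358bt1_3 hc Kp hKp 1 hram hord

/-! ### `228150bi1` @ `p = 3` (`3Ns`; `K⁺ = ℚ[x]/(x⁴ − 39x² − 130x − 156)`: `h = 2, 6, 6` at layers `0, 1, 2` (CERT, CERT, GRH), `e = 0, 1, 1`) -/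

set_option synthInstance.maxHeartbeats 400000 in
set_option maxHeartbeats 4000000 in
/-- **[NoF re-issue: the named facts `hLim`/`hF1`/`hF2`/`hCS` displayed by the original are DISCHARGED here by the tree theorems `…_holds` — read «modulo hLim/hF1/hF2/hCS» below as «no longer assumed».]** **(A) AT `(228150bi1, 3)` with `hμ` DISCHARGED by FUKUDA Thm. 1 (1) at layers `(1,2)` (`e₁ = e₂`)** (modulo `hCS`, `hFW`, `hF1`): `c` a complex conjugation, `Kp = ℚ(E[3])^c`
(`hKp`; `K⁺ = ℚ[x]/(x⁴ − 39x² − 130x − 156)`: `h = 2, 6, 6` at layers `0, 1, 2` (CERT, CERT, GRH), `e = 0, 1, 1`), displayed numerics: Fukuda index `0` (`hram`, exact) and `hord` (layer `1` certified, layer `2` under GRH; kit j308602).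
KERNEL: the `3Ns` image (g18). CONDITIONAL; nothing booked; (A)/BSD proved for no curve. [cite: Fukuda1994, Thm. 1 (1), p. 264] [cite: CoatesSujatha2005, Thm. 3.4 (§3)]
[cite: Cremona2006, Table 1 (Cremona label 228150bi1)] -/
theorem conjA_g228150bi1_3_fk12NoF
    (hFW : ferreroWashington1979_classicalMuVanishes)
    {W : WeierstrassCurve ℚ} [W.IsElliptic] (hWeq : W = (⟨1, (-1), 1, (-463430), (-274002803)⟩ : WeierstrassCurve ℚ))
    {c : absoluteGaloisGroup ℚ} (hc : IsComplexConjugation (Rat.castHom ℝ) c)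
    (Kp : IntermediateField ℚ ↥(W.divisionField 3)) (hKp : Kp = fixedField (Subgroup.zpowers (absRestrictNormalHom (W.divisionField 3) c)))
    (hram : ∀ κE : ZpExtension ↥Kp 3, κE.IsCyclotomic → TotallyRamifiedFrom κE 0)
    (hord : ∀ κE : ZpExtension ↥Kp 3, κE.IsCyclotomic → classNumberPExp κE (1 + 1) = classNumberPExp κE 1)
    (κ : ZpExtension ℚ 3) (hκ : κ.IsCyclotomic) :
    ∃ (γ : absoluteGaloisGroup ℚ) (Df : W.FineSelmerDualData κ γ),
      Module.Finite ℤ_[3] (RestrictScalars ℤ_[3] (IwasawaAlgebra 3) Df.X) := by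
  subst hWeq
  exact UnitIndexMuDoors.conjA_three_of_hasSplitCartanNormalizerModPImage_of_realSuccEqAt _ CoatesSujatha2005.thm34_fineSelmerDual_moduleFinite_of_classicalMuVanishes_divisionField_holds hFW fukuda1994_thm1_classNumberPExp_const_of_succ_eq_holds
    hasSplitCartanNormalizerModPImage_g228150bi1_3 hc Kp hKp 1 hram hord κ hκ

set_option synthInstance.maxHeartbeats 400000 in
set_option maxHeartbeats 4000000 in
/-- **[NoF re-issue: the named facts `hLim`/`hF1`/`hF2`/`hCS` displayed by the original are DISCHARGED here by the tree theorems `…_holds` — read «modulo hLim/hF1/hF2/hCS» below as «no longer assumed».]** **RECORD — U₀ `ord₃ #Ш(E) ≤ ord₃ #Ш_an(E)` for `E = 228150bi1` with `hμ` DISCHARGED by FUKUDA Thm. 1 (1) at layers `(1,2)` (`e₁ = e₂`)**: named facts {A161-fine `hKatoA`, GZK `hGZK`,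
modularity `hmod`, `hCS`, `hFW`, `hF1`}, Cremona's `r_an = 0` (`hr`), and the displayed layer data `hram` / `hord` of `Kp = ℚ(E[3])^c` (`K⁺ = ℚ[x]/(x⁴ − 39x² − 130x − 156)`: `h = 2, 6, 6` at layers `0, 1, 2` (CERT, CERT, GRH), `e = 0, 1, 1`;
kit j308602). KERNEL (g18): elliptic, minimal, `ClassO6 E 3`, `E[3]` irreducible, `3Ns` image. Supersedes the displayed-`hμ` record
`missingUpperBoundAt_g228150bi1_3`. Per row; nothing booked; BSD proved for no curve. [cite: Kato2004Asterisque, Thm. 14.5 (3) (p. 236)] [cite: Fukuda1994, Thm. 1 (1), p. 264]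
[cite: Cremona2006, Table 1 (Cremona label 228150bi1)] -/
theorem missingUpperBoundAt_g228150bi1_3_fk12NoF
    (hKatoA : Kato2004.rankZero_padicValNat_sha_add_padicValNat_tamagawa_le_of_additive_potGood_of_irreducible_of_fineSelmerDual_fg)
    (hGZK : rank_eq_analyticRank_of_analyticRank_le_one) (hmod : hasEntireLFunction_rat)
    (hFW : ferreroWashington1979_classicalMuVanishes)
    {W : WeierstrassCurve ℚ} [W.IsElliptic] [W.IsGloballyMinimal] (hWeq : W = (⟨1, (-1), 1, (-463430), (-274002803)⟩ : WeierstrassCurve ℚ)) (hr : W.analyticRank = 0)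
    {c : absoluteGaloisGroup ℚ} (hc : IsComplexConjugation (Rat.castHom ℝ) c)
    (Kp : IntermediateField ℚ ↥(W.divisionField 3)) (hKp : Kp = fixedField (Subgroup.zpowers (absRestrictNormalHom (W.divisionField 3) c)))
    (hram : ∀ κE : ZpExtension ↥Kp 3, κE.IsCyclotomic → TotallyRamifiedFrom κE 0)
    (hord : ∀ κE : ZpExtension ↥Kp 3, κE.IsCyclotomic → classNumberPExp κE (1 + 1) = classNumberPExp κE 1) :
    MissingUpperBoundAt W 3 := by
  subst hWeq
  haveI : Fact (Nat.Prime 3) := ⟨Nat.prime_three⟩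
  exact UnitIndexMuDoors.missingUpperBoundAt_three_of_hasSplitCartanNormalizerModPImage_of_realSuccEqAt _ hKatoA hGZK hmod CoatesSujatha2005.thm34_fineSelmerDual_moduleFinite_of_classicalMuVanishes_divisionField_holds hFW fukuda1994_thm1_classNumberPExp_const_of_succ_eq_holds
    hr classO6_g228150bi1_3 irr_g228150bi1_3 hasSplitCartanNormalizerModPImage_g228150bi1_3 hc Kp hKp 1 hram hord

/-! ### `228150bv1` @ `p = 3` (`3Ns`; `K⁺ = ℚ[x]/(x⁴ − 39x² − 130x − 156)`: `h = 2, 6, 6` at layers `0, 1, 2` (CERT, CERT, GRH), `e = 0, 1, 1`) -/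

set_option synthInstance.maxHeartbeats 400000 in
set_option maxHeartbeats 4000000 in
/-- **[NoF re-issue: the named facts `hLim`/`hF1`/`hF2`/`hCS` displayed by the original are DISCHARGED here by the tree theorems `…_holds` — read «modulo hLim/hF1/hF2/hCS» below as «no longer assumed».]** **(A) AT `(228150bv1, 3)` with `hμ` DISCHARGED by FUKUDA Thm. 1 (1) at layers `(1,2)` (`e₁ = e₂`)** (modulo `hCS`, `hFW`, `hF1`): `c` a complex conjugation, `Kp = ℚ(E[3])^c`
(`hKp`; `K⁺ = ℚ[x]/(x⁴ − 39x² − 130x − 156)`: `h = 2, 6, 6` at layers `0, 1, 2` (CERT, CERT, GRH), `e = 0, 1, 1`), displayed numerics: Fukuda index `0` (`hram`, exact) and `hord` (layer `1` certified, layer `2` under GRH; kit j308602).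
KERNEL: the `3Ns` image (g18). CONDITIONAL; nothing booked; (A)/BSD proved for no curve. [cite: Fukuda1994, Thm. 1 (1), p. 264] [cite: CoatesSujatha2005, Thm. 3.4 (§3)]
[cite: Cremona2006, Table 1 (Cremona label 228150bv1)] -/
theorem conjA_g228150bv1_3_fk12NoF
    (hFW : ferreroWashington1979_classicalMuVanishes)
    {W : WeierstrassCurve ℚ} [W.IsElliptic] (hWeq : W = (⟨1, (-1), 1, (-1314605), (-579653603)⟩ : WeierstrassCurve ℚ))
    {c : absoluteGaloisGroup ℚ} (hc : IsComplexConjugation (Rat.castHom ℝ) c)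
    (Kp : IntermediateField ℚ ↥(W.divisionField 3)) (hKp : Kp = fixedField (Subgroup.zpowers (absRestrictNormalHom (W.divisionField 3) c)))
    (hram : ∀ κE : ZpExtension ↥Kp 3, κE.IsCyclotomic → TotallyRamifiedFrom κE 0)
    (hord : ∀ κE : ZpExtension ↥Kp 3, κE.IsCyclotomic → classNumberPExp κE (1 + 1) = classNumberPExp κE 1)
    (κ : ZpExtension ℚ 3) (hκ : κ.IsCyclotomic) :
    ∃ (γ : absoluteGaloisGroup ℚ) (Df : W.FineSelmerDualData κ γ),
      Module.Finite ℤ_[3] (RestrictScalars ℤ_[3] (IwasawaAlgebra 3) Df.X) := by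
  subst hWeq
  exact UnitIndexMuDoors.conjA_three_of_hasSplitCartanNormalizerModPImage_of_realSuccEqAt _ CoatesSujatha2005.thm34_fineSelmerDual_moduleFinite_of_classicalMuVanishes_divisionField_holds hFW fukuda1994_thm1_classNumberPExp_const_of_succ_eq_holds
    hasSplitCartanNormalizerModPImage_g228150bv1_3 hc Kp hKp 1 hram hord κ hκ

set_option synthInstance.maxHeartbeats 400000 in
set_option maxHeartbeats 4000000 in
/-- **[NoF re-issue: the named facts `hLim`/`hF1`/`hF2`/`hCS` displayed by the original are DISCHARGED here by the tree theorems `…_holds` — read «modulo hLim/hF1/hF2/hCS» below as «no longer assumed».]** **RECORD — U₀ `ord₃ #Ш(E) ≤ ord₃ #Ш_an(E)` for `E = 228150bv1` with `hμ` DISCHARGED by FUKUDA Thm. 1 (1) at layers `(1,2)` (`e₁ = e₂`)**: named facts {A161-fine `hKatoA`, GZK `hGZK`,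
modularity `hmod`, `hCS`, `hFW`, `hF1`}, Cremona's `r_an = 0` (`hr`), and the displayed layer data `hram` / `hord` of `Kp = ℚ(E[3])^c` (`K⁺ = ℚ[x]/(x⁴ − 39x² − 130x − 156)`: `h = 2, 6, 6` at layers `0, 1, 2` (CERT, CERT, GRH), `e = 0, 1, 1`;
kit j308602). KERNEL (g18): elliptic, minimal, `ClassO6 E 3`, `E[3]` irreducible, `3Ns` image. Supersedes the displayed-`hμ` record
`missingUpperBoundAt_g228150bv1_3`. Per row; nothing booked; BSD proved for no curve. [cite: Kato2004Asterisque, Thm. 14.5 (3) (p. 236)] [cite: Fukuda1994, Thm. 1 (1), p. 264]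
[cite: Cremona2006, Table 1 (Cremona label 228150bv1)] -/
theorem missingUpperBoundAt_g228150bv1_3_fk12NoF
    (hKatoA : Kato2004.rankZero_padicValNat_sha_add_padicValNat_tamagawa_le_of_additive_potGood_of_irreducible_of_fineSelmerDual_fg)
    (hGZK : rank_eq_analyticRank_of_analyticRank_le_one) (hmod : hasEntireLFunction_rat)
    (hFW : ferreroWashington1979_classicalMuVanishes)
    {W : WeierstrassCurve ℚ} [W.IsElliptic] [W.IsGloballyMinimal] (hWeq : W = (⟨1, (-1), 1, (-1314605), (-579653603)⟩ : WeierstrassCurve ℚ)) (hr : W.analyticRank = 0)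
    {c : absoluteGaloisGroup ℚ} (hc : IsComplexConjugation (Rat.castHom ℝ) c)
    (Kp : IntermediateField ℚ ↥(W.divisionField 3)) (hKp : Kp = fixedField (Subgroup.zpowers (absRestrictNormalHom (W.divisionField 3) c)))
    (hram : ∀ κE : ZpExtension ↥Kp 3, κE.IsCyclotomic → TotallyRamifiedFrom κE 0)
    (hord : ∀ κE : ZpExtension ↥Kp 3, κE.IsCyclotomic → classNumberPExp κE (1 + 1) = classNumberPExp κE 1) :
    MissingUpperBoundAt W 3 := by
  subst hWeq
  haveI : Fact (Nat.Prime 3) := ⟨Nat.prime_three⟩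
  exact UnitIndexMuDoors.missingUpperBoundAt_three_of_hasSplitCartanNormalizerModPImage_of_realSuccEqAt _ hKatoA hGZK hmod CoatesSujatha2005.thm34_fineSelmerDual_moduleFinite_of_classicalMuVanishes_divisionField_holds hFW fukuda1994_thm1_classNumberPExp_const_of_succ_eq_holds
    hr classO6_g228150bv1_3 irr_g228150bv1_3 hasSplitCartanNormalizerModPImage_g228150bv1_3 hc Kp hKp 1 hram hord

end Summit.BirchSwinnertonDyer.BirchSwinnertonDyer.Theorems.WildUpperUnitTwistRecords

end
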